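import Summits.BirchSwinnertonDyer.BirchSwinnertonDyer.Theorems.ClassRecordThreeEulerHalvesAtThreeCartanTorusCubeCutTori
import HarnessLib

/-!
# Crux 23422 line `cartan` v8′, stub (F2a), PRINCIPAL-SERIES half of the torus-cube cut — file PS-1: the ℤ-lattice
# idempotent∕trace toolkit, LEMMA Z (the centre of `GL₂(𝔽_q)` acts trivially on every Cartan torus lattice), and the
# factorisation `N_{T_s} = (q − 1)·N_D` through the mirabolic torus `D = {diag(a,1)}` (gives (P3)'s second conjunct outright)

Seat `bsd-stepL-cartan-f2a` g0 (explicit unit, pen g44 AUTOFILL #2 row (3′); `--supports stmt-BirchSwinnertonDyer-23422`).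
Everything here is elementary averaging on ONE lattice `X = ℤ^d` with a `GL₂(𝔽_q)`-action of character `χ_W`
(`CartanDegree.CartanTorusLattice`, p677910) and uses only the FRAME (`…CartanTorusCubeCutFrame`, p680737: `normOp`,
`splitTorus`, …) and the TORI file (`…CartanTorusCubeCutTori`, p681375: `diagGL`, `splitTorus_eq_image`):
* `eq_zero_of_mul_self_eq_smul_of_trace_eq_zero`: an endomorphism `N` of `ℤ^d` with `N² = c·N` (`c ≠ 0`) and `tr N = 0`
  vanishes (pass to `ℚ`, where `c⁻¹N` is an idempotent of trace `0`; Mathlib `LinearMap.IsIdempotentElem.eq_zero_of_trace_eq_zero`);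
* `normOp_mul_self`, `trace_normOp`: for a multiplicatively closed `S ⊂ G`, `N_S² = |S|·N_S` and `tr N_S = Σ_{t∈S} χ_W(t)`;
  hence `N_S = 0` when the character sum vanishes (`normOp_eq_zero_of_sum_char_eq_zero`) and `N_S = |S|·1` when it is
  `|S|·d` (`normOp_eq_card_smul_one_of_sum_char`);
* LEMMA Z (`rho_eq_one_of_isScalar`): `χ_W(a·1) = χ_W(1) = d`, so `N_Z = |Z|·1` (`normOp_centre`) and every scalar matrix acts as the identity;
* `normOp_splitTorus_eq`: `N_{T_s} = (q − 1)·N_D` with `N_D = Σ_{a ∈ 𝔽_q^×} ρ(diag(a,1))` (written as an explicit sum over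
  `diagGL ![a, 1]`, no new definition); consequently (`three_pow_dvd_coeff_normOp_splitTorus`) every split-torus norm coefficient
  along `w_S ≠ 0` is divisible by `q − 1`, in particular by `3^{ord₃(q−1)}` — the second conjunct of stub (P3) `P_psNonsplitNormSharp`
  of `Cruxes/EulerHalvesAtThree/Lines/cartan_sk1.lean` (bsd-idea-10 g11), for every `g` (and `w_S ≠ 0` follows from
  `ne_zero_of_normOp_along` once `Σ_{T_s} χ_W ≠ 0`, file PS-2).
HONEST FRAMING: nothing here is specific to `q ≡ 1 (mod 3)`; no modular representation theory is used; S-K1′ is NOT proved, no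
summit statement, no route item and no registered stub is proved; BSD is proved for no curve. [folklore; background cite: Bump1997, §4.1]
-/

namespace Summit.BirchSwinnertonDyer.BirchSwinnertonDyer.Theorems.CartanTorusCubeCut.PS

open Summit.BirchSwinnertonDyer.BirchSwinnertonDyer.Theorems.CartanDegree
open Summit.BirchSwinnertonDyer.BirchSwinnertonDyer.Theorems.CartanTorusCubeCut

set_option linter.dupNamespace false
set_option autoImplicit false

/-! ### The ℤ-lattice idempotent∕trace lemma -/

/-- trace of an entrywise-mapped matrix. -/
theorem trace_map_intCast {d : ℕ} (M : Matrix (Fin d) (Fin d) ℤ) :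
    (M.map (Int.castRingHom ℚ)).trace = (M.trace : ℚ) := by
  simp [Matrix.trace, Matrix.map_apply]

/-- **An endomorphism `N` of `ℤ^d` with `N ∘ N = c • N`, `c ≠ 0`, and trace `0` is zero** (over `ℚ`, `c⁻¹ N` is an
idempotent with trace `0`, hence `0`). -/
theorem eq_zero_of_mul_self_eq_smul_of_trace_eq_zero {d : ℕ} (N : (Fin d → ℤ) →ₗ[ℤ] (Fin d → ℤ)) (c : ℤ)
    (hc : c ≠ 0) (hN : N * N = c • N) (htr : LinearMap.trace ℤ _ N = 0) : N = 0 := by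
  classical
  set M : Matrix (Fin d) (Fin d) ℤ := LinearMap.toMatrix' N with hM_def
  have hM : M * M = c • M := by
    rw [hM_def, ← LinearMap.toMatrix'_mul, hN, map_zsmul]
  have hMtr : M.trace = 0 := by
    rw [hM_def, ← LinearMap.toMatrix_eq_toMatrix', ← LinearMap.trace_eq_matrix_trace, htr]
  set Mq : Matrix (Fin d) (Fin d) ℚ := M.map (Int.castRingHom ℚ) with hMq_def
  have hMq : Mq * Mq = (c : ℚ) • Mq := by
    rw [hMq_def, ← Matrix.map_mul, hM]
    ext i j
    simp only [Matrix.map_apply, Matrix.smul_apply, smul_eq_mul, map_mul, eq_intCast]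
  have hMqtr : Mq.trace = 0 := by
    rw [hMq_def, trace_map_intCast, hMtr, Int.cast_zero]
  -- the idempotent `e = c⁻¹ • Mq` (as an endomorphism of `ℚ^d`)
  set e : (Fin d → ℚ) →ₗ[ℚ] (Fin d → ℚ) := (c : ℚ)⁻¹ • Matrix.toLin' Mq with he_def
  have hcq : (c : ℚ) ≠ 0 := by exact_mod_cast hc
  have he : IsIdempotentElem e := by
    change e * e = e
    rw [he_def, smul_mul_smul_comm, Module.End.mul_eq_comp, ← Matrix.toLin'_mul, hMq, map_smul, smul_smul,
      mul_assoc, inv_mul_cancel₀ hcq, mul_one]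
  have hetr : LinearMap.trace ℚ _ e = 0 := by
    rw [he_def, map_smul, Matrix.trace_toLin'_eq, hMqtr, smul_zero]
  have he0 : e = 0 := LinearMap.IsIdempotentElem.eq_zero_of_trace_eq_zero he hetr
  have hMq0 : Mq = 0 := by
    have h1 : Matrix.toLin' Mq = 0 := by
      have := congrArg (fun f => (c : ℚ) • f) he0
      simpa [he_def, smul_smul, mul_inv_cancel₀ hcq] using this
    exact Matrix.toLin'.injective (by rw [h1, map_zero])
  have hM0 : M = 0 := by
    ext i j
    have := congrFun (congrFun hMq0 i) j
    simpa [hMq_def, Matrix.map_apply] using this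
  exact LinearMap.toMatrix'.injective (by rw [← hM_def, hM0, map_zero])


/-! ### Scalar matrices and the character -/

section Scalar
variable {q : ℕ}

/-- the discriminant `tr² − 4 det` of a scalar matrix vanishes. -/
theorem discr_eq_zero_of_isScalar {M : Mat q} (hM : IsScalarMat M) : M.trace ^ 2 - 4 * M.det = 0 := by
  obtain ⟨h01, h10, h00⟩ := hM
  rw [Matrix.trace_fin_two, Matrix.det_fin_two, h01, h00]
  ring

/-- the character value at a scalar matrix (the scalar branch of `cubicNewvectorCharMat`). -/
theorem charMat_of_isScalar {M : Mat q} (hM : IsScalarMat M) :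
    cubicNewvectorCharMat q M = if q % 3 = 1 then (q : ℤ) + 1 else (q : ℤ) - 1 := by
  have hΔ : M.trace ^ 2 - 4 * M.det = 0 := discr_eq_zero_of_isScalar hM
  simp [cubicNewvectorCharMat, hΔ, hM]

/-- `1` is a scalar matrix. -/
theorem isScalarMat_one : IsScalarMat (1 : Mat q) := by
  refine ⟨?_, ?_, ?_⟩ <;> simp

/-- the character value at a scalar element equals the one at `1`. -/
theorem char_of_isScalar {z : GL (Fin 2) (ZMod q)} (hz : IsScalarMat (z : Mat q)) :
    cubicNewvectorChar q z = cubicNewvectorChar q 1 := by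
  unfold cubicNewvectorChar
  rw [charMat_of_isScalar hz, Units.val_one, charMat_of_isScalar isScalarMat_one]

end Scalar

variable {q : ℕ} [Fact q.Prime]

/-! ### Norm operators of multiplicatively closed sets -/

section NormOp
variable (𝓛 : CartanTorusLattice q)

/-- `N_S ∘ N_S = |S| • N_S` for a multiplicatively closed `S`. -/
theorem normOp_mul_self {S : Finset (G q)} (hS : ∀ u ∈ S, ∀ s ∈ S, u * s ∈ S) :
    normOp 𝓛 S * normOp 𝓛 S = (S.card : ℤ) • normOp 𝓛 S := by
  have h1 : ∀ u ∈ S, 𝓛.ρ u * normOp 𝓛 S = normOp 𝓛 S := fun u hu =>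
    LinearMap.ext fun x => rho_mul_normOp 𝓛 hS hu x
  calc normOp 𝓛 S * normOp 𝓛 S = ∑ u ∈ S, 𝓛.ρ u * normOp 𝓛 S := by rw [normOp, Finset.sum_mul]
    _ = ∑ u ∈ S, normOp 𝓛 S := Finset.sum_congr rfl h1
    _ = (S.card : ℤ) • normOp 𝓛 S := by rw [Finset.sum_const, ← Nat.cast_smul_eq_nsmul ℤ]

omit [Fact q.Prime] in
/-- `tr N_S = Σ_{t ∈ S} χ_W(t)`. -/
theorem trace_normOp (S : Finset (G q)) :
    LinearMap.trace ℤ _ (normOp 𝓛 S) = ∑ t ∈ S, cubicNewvectorChar q t := by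
  rw [normOp, map_sum]
  exact Finset.sum_congr rfl fun t _ => 𝓛.trace_eq t

/-- a multiplicatively closed `S` whose character sum vanishes has `N_S = 0`. -/
theorem normOp_eq_zero_of_sum_char_eq_zero {S : Finset (G q)} (hS : ∀ u ∈ S, ∀ s ∈ S, u * s ∈ S)
    (hne : S.Nonempty) (h0 : ∑ t ∈ S, cubicNewvectorChar q t = 0) : normOp 𝓛 S = 0 :=
  eq_zero_of_mul_self_eq_smul_of_trace_eq_zero _ (S.card : ℤ) (by exact_mod_cast hne.card_pos.ne')
    (normOp_mul_self 𝓛 hS) (by rw [trace_normOp, h0])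

omit [Fact q.Prime] in
/-- the rank of the lattice is the character value at `1`. -/
theorem d_eq_char_one : (𝓛.d : ℤ) = cubicNewvectorChar q 1 := by
  rw [← 𝓛.trace_eq 1, map_one, LinearMap.trace_one, Module.finrank_fin_fun]

/-- a multiplicatively closed `S` whose character sum is `|S|·d` has `N_S = |S|·1` (every element of `S` then acts
trivially, see `rho_eq_one_of_normOp_eq`). -/
theorem normOp_eq_card_smul_one_of_sum_char {S : Finset (G q)} (hS : ∀ u ∈ S, ∀ s ∈ S, u * s ∈ S)
    (hne : S.Nonempty) (h : ∑ t ∈ S, cubicNewvectorChar q t = (S.card : ℤ) * 𝓛.d) :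
    normOp 𝓛 S = (S.card : ℤ) • (1 : (Fin 𝓛.d → ℤ) →ₗ[ℤ] (Fin 𝓛.d → ℤ)) := by
  set Q := (S.card : ℤ) • (1 : (Fin 𝓛.d → ℤ) →ₗ[ℤ] (Fin 𝓛.d → ℤ)) - normOp 𝓛 S with hQ
  have hcard : (S.card : ℤ) ≠ 0 := by exact_mod_cast hne.card_pos.ne'
  have hQQ : Q * Q = (S.card : ℤ) • Q := by
    rw [hQ, sub_mul, mul_sub, mul_sub, normOp_mul_self 𝓛 hS, smul_mul_assoc, one_mul, smul_mul_assoc,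
      one_mul, mul_smul_comm, mul_one, smul_sub, smul_smul]
    abel
  have hQtr : LinearMap.trace ℤ _ Q = 0 := by
    rw [hQ, map_sub, map_zsmul, LinearMap.trace_one, Module.finrank_fin_fun, trace_normOp, h]
    simp
  have := eq_zero_of_mul_self_eq_smul_of_trace_eq_zero Q (S.card : ℤ) hcard hQQ hQtr
  rw [hQ, sub_eq_zero] at this
  exact this.symm

/-- if `N_S = |S|·1` for a multiplicatively closed `S`, every element of `S` acts as the identity. -/
theorem rho_eq_one_of_normOp_eq {S : Finset (G q)} (hS : ∀ u ∈ S, ∀ s ∈ S, u * s ∈ S)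
    (hN : normOp 𝓛 S = (S.card : ℤ) • (1 : (Fin 𝓛.d → ℤ) →ₗ[ℤ] (Fin 𝓛.d → ℤ))) {u : G q} (hu : u ∈ S) :
    𝓛.ρ u = 1 := by
  have hcard : (S.card : ℤ) ≠ 0 := by exact_mod_cast (Finset.card_pos.2 ⟨u, hu⟩).ne'
  have h1 : 𝓛.ρ u * normOp 𝓛 S = normOp 𝓛 S := LinearMap.ext fun x => rho_mul_normOp 𝓛 hS hu x
  rw [hN, mul_smul_comm, mul_one] at h1
  exact smul_right_injective _ hcard h1

end NormOp

/-! ### LEMMA Z: the centre acts trivially -/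

section Centre
open scoped Classical
variable (𝓛 : CartanTorusLattice q)

/-- the invertible scalar matrices are closed under multiplication. -/
theorem isScalarMat_mul {u s : G q} (hu : IsScalarMat (u : Mat q)) (hs : IsScalarMat (s : Mat q)) :
    IsScalarMat ((u * s : G q) : Mat q) := by
  obtain ⟨hu01, hu10, hu00⟩ := hu
  obtain ⟨hs01, hs10, hs00⟩ := hs
  refine ⟨?_, ?_, ?_⟩ <;>
    simp [Units.val_mul, Matrix.mul_apply, Fin.sum_univ_two, hu01, hu10, hu00, hs01, hs10, hs00]

/-- `N_Z = |Z|·1` for the centre `Z = {g : g scalar}` (its character sum is `|Z|·χ_W(1) = |Z|·d`). -/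
theorem normOp_centre :
    normOp 𝓛 (Finset.univ.filter fun g : G q => IsScalarMat (g : Mat q)) =
      ((Finset.univ.filter fun g : G q => IsScalarMat (g : Mat q)).card : ℤ) •
        (1 : (Fin 𝓛.d → ℤ) →ₗ[ℤ] (Fin 𝓛.d → ℤ)) := by
  refine normOp_eq_card_smul_one_of_sum_char 𝓛 (fun u hu s hs => ?_) ⟨1, ?_⟩ ?_
  · simp only [Finset.mem_filter, Finset.mem_univ, true_and] at hu hs ⊢
    exact isScalarMat_mul hu hs
  · simpa using (isScalarMat_one (q := q))
  · rw [d_eq_char_one 𝓛, ← nsmul_eq_mul, ← Finset.sum_const]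
    refine Finset.sum_congr rfl fun z hz => char_of_isScalar ?_
    simpa using hz

/-- **LEMMA Z**: every invertible scalar matrix acts as the identity on a Cartan torus lattice. -/
theorem rho_eq_one_of_isScalar {z : G q} (hz : IsScalarMat (z : Mat q)) : 𝓛.ρ z = 1 := by
  refine rho_eq_one_of_normOp_eq 𝓛 (S := Finset.univ.filter fun g : G q => IsScalarMat (g : Mat q))
    (fun u hu s hs => ?_) (normOp_centre 𝓛) (by simpa using hz)
  simp only [Finset.mem_filter, Finset.mem_univ, true_and] at hu hs ⊢
  exact isScalarMat_mul hu hs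

/-- pointwise form of LEMMA Z. -/
theorem rho_apply_of_isScalar {z : G q} (hz : IsScalarMat (z : Mat q)) (x : Fin 𝓛.d → ℤ) : 𝓛.ρ z x = x := by
  rw [rho_eq_one_of_isScalar 𝓛 hz]; rfl

end Centre

/-! ### The mirabolic torus `D = {diag(a,1)}` and the factorisation `N_{T_s} = (q − 1)·N_D`

No new definition is introduced: `N_D` is written as the explicit sum `Σ_{a ∈ 𝔽_q^×} ρ(diag(a,1))` over `diagGL ![a, 1]`. -/

/-- `diagGL` is multiplicative. -/
theorem diagGL_mul (u v : Fin 2 → (ZMod q)ˣ) : diagGL u * diagGL v = diagGL (u * v) := by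
  simp only [diagGL, map_mul]

/-- `diag(a,1)·diag(b,1) = diag(ab,1)`. -/
theorem diagGL_mirabolic_mul (a b : (ZMod q)ˣ) : diagGL ![a, 1] * diagGL ![b, 1] = diagGL ![a * b, 1] := by
  rw [diagGL_mul]
  congr 1
  funext i
  fin_cases i <;> simp

/-- `diag(a,a)` is a scalar matrix. -/
theorem isScalarMat_diagGL_const (a : (ZMod q)ˣ) : IsScalarMat ((diagGL ![a, a] : G q) : Mat q) := by
  rw [diagGL_coe]
  refine ⟨?_, ?_, ?_⟩ <;> simp [Matrix.diagonal]

/-- `diag(u₀, u₁) = diag(u₁, u₁) · diag(u₀/u₁, 1)`: `T_s = Z · D`. -/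
theorem diagGL_eq_centre_mul_mirabolic (u : Fin 2 → (ZMod q)ˣ) :
    diagGL u = diagGL ![u 1, u 1] * diagGL ![u 0 * (u 1)⁻¹, 1] := by
  rw [diagGL_mul]
  congr 1
  funext i
  fin_cases i
  · simp
  · simp

section SplitTorus
variable (𝓛 : CartanTorusLattice q)

/-- on the lattice, `ρ(diag(u₀,u₁)) = ρ(diag(u₀/u₁, 1))` (LEMMA Z). -/
theorem rho_diagGL (u : Fin 2 → (ZMod q)ˣ) : 𝓛.ρ (diagGL u) = 𝓛.ρ (diagGL ![u 0 * (u 1)⁻¹, 1]) := by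
  rw [diagGL_eq_centre_mul_mirabolic u, map_mul, rho_eq_one_of_isScalar 𝓛 (isScalarMat_diagGL_const (u 1)), one_mul]

/-- **`N_{T_s} = (q − 1) · N_D`**, `N_D = Σ_a ρ(diag(a,1))` (the centre accounts for the factor `q − 1 = |Z|`). -/
theorem normOp_splitTorus_eq :
    normOp 𝓛 (splitTorus q) = ((q - 1 : ℕ) : ℤ) • ∑ a : (ZMod q)ˣ, 𝓛.ρ (diagGL ![a, 1]) := by
  rw [normOp, splitTorus_eq_image, Finset.sum_image (fun u _ v _ h => diagGL_injective h)]
  let e : (Fin 2 → (ZMod q)ˣ) ≃ (ZMod q)ˣ × (ZMod q)ˣ :=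
    ⟨fun u => (u 0 * (u 1)⁻¹, u 1), fun p => ![p.1 * p.2, p.2],
      fun u => by funext i; fin_cases i <;> simp, fun p => by simp⟩
  calc ∑ u : Fin 2 → (ZMod q)ˣ, 𝓛.ρ (diagGL u)
      = ∑ u : Fin 2 → (ZMod q)ˣ, 𝓛.ρ (diagGL ![(e u).1, 1]) :=
        Finset.sum_congr rfl fun u _ => rho_diagGL 𝓛 u
    _ = ∑ p : (ZMod q)ˣ × (ZMod q)ˣ, 𝓛.ρ (diagGL ![p.1, 1]) :=
        Fintype.sum_equiv e _ (fun p => 𝓛.ρ (diagGL ![p.1, 1])) (fun _ => rfl)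
    _ = ∑ a : (ZMod q)ˣ, ∑ _b : (ZMod q)ˣ, 𝓛.ρ (diagGL ![a, 1]) := Fintype.sum_prod_type _
    _ = ((q - 1 : ℕ) : ℤ) • ∑ a : (ZMod q)ˣ, 𝓛.ρ (diagGL ![a, 1]) := by
        rw [Finset.smul_sum]
        refine Finset.sum_congr rfl fun a _ => ?_
        rw [Finset.sum_const, Finset.card_univ, ZMod.card_units, Nat.cast_smul_eq_nsmul]

/-- `N_D y` is fixed by every `diag(b, 1)`. -/
theorem rho_mirabolic_sum (b : (ZMod q)ˣ) (y : Fin 𝓛.d → ℤ) :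
    𝓛.ρ (diagGL ![b, 1]) (∑ a : (ZMod q)ˣ, 𝓛.ρ (diagGL ![a, 1]) y) =
      ∑ a : (ZMod q)ˣ, 𝓛.ρ (diagGL ![a, 1]) y := by
  rw [map_sum]
  simp_rw [← Module.End.mul_apply, ← map_mul, diagGL_mirabolic_mul]
  exact Fintype.sum_equiv (Equiv.mulLeft b) _ _ (fun _ => rfl)

/-- `N_D y` is `T_s`-fixed (`D`-fixed by closure, `Z`-fixed by LEMMA Z). -/
theorem isSplitFixed_mirabolic_sum (y : Fin 𝓛.d → ℤ) :
    𝓛.IsSplitFixed (∑ a : (ZMod q)ˣ, 𝓛.ρ (diagGL ![a, 1]) y) := by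
  intro g hg01 hg10
  have hg : g ∈ splitTorus q := by simp [splitTorus, hg01, hg10]
  rw [splitTorus_eq_image] at hg
  simp only [Finset.mem_image, Finset.mem_univ, true_and] at hg
  obtain ⟨u, rfl⟩ := hg
  rw [rho_diagGL 𝓛 u]
  exact rho_mirabolic_sum 𝓛 _ y

omit [Fact q.Prime] in
/-- a vector along which a norm operator with non-zero character sum lands is non-zero. -/
theorem ne_zero_of_normOp_along {S : Finset (G q)} {w : Fin 𝓛.d → ℤ} (hgen : ∀ x, ∃ m : ℤ, normOp 𝓛 S x = m • w)
    (htr : ∑ t ∈ S, cubicNewvectorChar q t ≠ 0) : w ≠ 0 := by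
  rintro rfl
  apply htr
  rw [← trace_normOp 𝓛 S]
  have : normOp 𝓛 S = 0 := LinearMap.ext fun x => by obtain ⟨m, hm⟩ := hgen x; simpa using hm
  rw [this, map_zero]

/-- the split norm of any vector is `(q − 1)·m′·w_S` with `N_D y = m′·w_S`. -/
theorem coeff_normOp_splitTorus_eq {wS : Fin 𝓛.d → ℤ} (hwS : wS ≠ 0)
    (hSgen : ∀ v, 𝓛.IsSplitFixed v → ∃ m : ℤ, v = m • wS) (y : Fin 𝓛.d → ℤ) (m : ℤ)
    (h : normOp 𝓛 (splitTorus q) y = m • wS) :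
    ∃ m' : ℤ, (∑ a : (ZMod q)ˣ, 𝓛.ρ (diagGL ![a, 1]) y) = m' • wS ∧ m = ((q - 1 : ℕ) : ℤ) * m' := by
  obtain ⟨m', hm'⟩ := hSgen _ (isSplitFixed_mirabolic_sum 𝓛 y)
  refine ⟨m', hm', ?_⟩
  rw [normOp_splitTorus_eq, LinearMap.smul_apply, LinearMap.sum_apply, hm', smul_smul] at h
  exact (smul_left_injective ℤ hwS h).symm

/-- **(P3), second conjunct, for EVERY vector**: a split-torus norm coefficient along `w_S ≠ 0` is divisible by `q − 1`,
hence by `3^{ord₃(q−1)}`. -/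
theorem three_pow_dvd_coeff_normOp_splitTorus {wS : Fin 𝓛.d → ℤ} (hwS : wS ≠ 0)
    (hSgen : ∀ v, 𝓛.IsSplitFixed v → ∃ m : ℤ, v = m • wS) (y : Fin 𝓛.d → ℤ) (m : ℤ)
    (h : normOp 𝓛 (splitTorus q) y = m • wS) : (3 : ℤ) ^ padicValNat 3 (q - 1) ∣ m := by
  obtain ⟨m', -, rfl⟩ := coeff_normOp_splitTorus_eq 𝓛 hwS hSgen y m h
  have h3 : ((3 ^ padicValNat 3 (q - 1) : ℕ) : ℤ) ∣ ((q - 1 : ℕ) : ℤ) :=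
    Int.natCast_dvd_natCast.2 pow_padicValNat_dvd
  push_cast at h3
  exact h3.mul_right m'

end SplitTorus

end Summit.BirchSwinnertonDyer.BirchSwinnertonDyer.Theorems.CartanTorusCubeCut.PS
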